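import Literature.MathematicalPhysics.QuantumFieldTheory.Balaban1983to89.BlockAveragingPlaquetteBound
import Literature.MathematicalPhysics.QuantumFieldTheory.Balaban1983to89.MatrixLogLipschitz
import Literature.Analysis.Calculus.BCHProductLowOrder
import HarnessLib

/-!
# S2β · `hFlat` road, brick (G12 = F4's analytic core) of UV3-NODE §64.6 (3) — THE CORRECTION FACTOR IS MEAN-FLUX SMALL:
# `dist1 (corr ℰp U c) ≤ 3·mean_i dist1 (loopHol U c i)` (linear in the MEAN loop flux, not in the sup), for the record's exp-mean-log average

Cell `ym3-torus` (rung R3 = continuum `SU(2)` Yang–Mills on the three-torus — NOT d = 4, NOT infinite volume, NOT a mass gap, NOT Clay).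
Width seat «width 8» `ym3-torus-px8` (gen 21), FREE px helper on crux `stmt-QuantumFields-20520`, count-neutral, DEFINITION-FREE.

WHY.  Feeder F4 of (H) in ✓p816498 `…HFlatOfRelativeLetter` is the `ℓ²` corr letter `‖dist1 corr‖₂ ≤ C·‖flux‖₂`.  The tree has the SUP forms (lit
✓`dist1_ESU_le` `≤ 6t`, ✓`dist1_corr_le_two_mul`, ✓`dist1_corr_le_local`), which are threshold-small but not `ℓ²`-chargeable.  Here the MEAN form:
`‖eml W − 1‖ = ‖exp(mean log W_i) − 1‖ ≤ 2‖mean log W_i‖ ≤ 2·mean‖log W_i‖ ≤ (2∕(1−t))·mean‖W_i − 1‖` — so `dist1 corr ≤ 3·mean_i dist1(loop_i)`, and the `ℓ²`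
letter follows from the ribbon kernel of the (0.4) loops by ✓`schur_test` (px10 g22's (C)-STEP counts; not done here).
* §1 `norm_mean_le_mean_norm`, ★ `norm_eml_sub_one_le_mean` (Banach algebra: `‖W_i − 1‖ ≤ t ≤ 1∕4` ⟹ `‖eml W − 1‖ ≤ 3·mean_i‖W_i − 1‖`).
* §2 ★★ `dist1_ESU_le_mean`, `dist1_expMeanLogSU_avg_le_mean` (`SU(N)`, `dist1` clothes), ★★ `dist1_corr_le_mean` (the record's `corr` on the small-field domain).

HONEST SCOPE.  Elementary estimates over the tree's `eml`∕`ESU`; nothing of Bałaban's analysis; the ribbon kernel count, the `ℓ²` letter F4 itself, `hFlat`, TUBE-REG∘,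
GAP♯∘, S2β, crux 20520 and `YM3TorusSU2` are NOT proved; no registered stub is closed; the Yang–Mills mass gap is NOT proved.
References: T. Bałaban, CMP **98** (1985) [Balaban1985Averaging] ((26)–(27) p.22); T. Bałaban, CMP **109** (1987) [Balaban1987RG1] ((0.4) p.253).
-/

set_option autoImplicit false

noncomputable section

open NormedSpace Finset
open scoped BigOperators Matrix.Norms.L2Operator

namespace Summit.QuantumFields.YangMills.Theorems.FluctuationComparisonRegPrIntLS2BetaCorrMeanFlux

open Literature.MathematicalPhysics.QuantumFieldTheory.Balaban1983to89
open Literature.MathematicalPhysics.QuantumFieldTheory.Balaban1983to89.MatrixLog (mlog norm_mlog_le_div)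
open Literature.MathematicalPhysics.QuantumFieldTheory.Balaban1983to89.ExpMeanLog (eml eml_eq_exp ESU coe_ESU_of_small deltaSU expMeanLogSU)
open Literature.MathematicalPhysics.QuantumFieldTheory.Balaban1983to89.BlockAveraging (loopHol Small corr Idx)
open Literature.Analysis.Calculus.ExpDifferential (norm_exp_sub_one_le_exp_norm_sub_one)

/-! ## §1 Banach algebra -/

section Banach

variable {𝔸 : Type*} [NormedRing 𝔸] [NormedAlgebra ℂ 𝔸] [CompleteSpace 𝔸]
variable {ι : Type*} [Fintype ι] [Nonempty ι]

omit [CompleteSpace 𝔸] [Nonempty ι] in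
/-- `‖|I|⁻¹ Σ a_i‖ ≤ |I|⁻¹ Σ ‖a_i‖` (complex scalar `|I|⁻¹`). [folklore] -/
theorem norm_mean_le_mean_norm (a : ι → 𝔸) :
    ‖((Fintype.card ι : ℂ))⁻¹ • ∑ i, a i‖ ≤ ((Fintype.card ι : ℝ))⁻¹ * ∑ i, ‖a i‖ := by
  rw [norm_smul, norm_inv, Complex.norm_natCast]
  exact mul_le_mul_of_nonneg_left (norm_sum_le _ _) (inv_nonneg.mpr (Nat.cast_nonneg _))

/-- ★ **`exp[mean log]` IS MEAN-SMALL**: `‖W_i − 1‖ ≤ t ≤ 1∕4` for all `i` ⟹ `‖eml W − 1‖ ≤ 3·|I|⁻¹Σ_i‖W_i − 1‖`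
(`‖log W_i‖ ≤ ‖W_i − 1‖∕(1−t)`, `‖mean‖ ≤ mean‖·‖`, `|e^x − 1| ≤ 2|x|` for `|x| ≤ 1`). [cite: Balaban1985Averaging, (26)-(27) p.22] -/
theorem norm_eml_sub_one_le_mean {W : ι → 𝔸} {t : ℝ} (hW : ∀ i, ‖W i - 1‖ ≤ t) (ht : t ≤ 1 / 4) :
    ‖eml W - 1‖ ≤ 3 * (((Fintype.card ι : ℝ))⁻¹ * ∑ i, ‖W i - 1‖) := by
  have h0 : 0 ≤ t := (norm_nonneg _).trans (hW (Classical.arbitrary ι))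
  set B : 𝔸 := ((Fintype.card ι : ℂ))⁻¹ • ∑ i, mlog (W i) with hB
  set m : ℝ := ((Fintype.card ι : ℝ))⁻¹ * ∑ i, ‖W i - 1‖ with hm
  have hm0 : 0 ≤ m := mul_nonneg (inv_nonneg.mpr (Nat.cast_nonneg _)) (Finset.sum_nonneg fun _ _ => norm_nonneg _)
  have hmt : m ≤ t := by
    have hc : (0 : ℝ) < Fintype.card ι := Nat.cast_pos.mpr Fintype.card_pos
    calc m ≤ ((Fintype.card ι : ℝ))⁻¹ * ∑ _i : ι, t :=
          mul_le_mul_of_nonneg_left (Finset.sum_le_sum fun i _ => hW i) (inv_nonneg.mpr hc.le)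
      _ = t := by rw [Finset.sum_const, Finset.card_univ, nsmul_eq_mul, inv_mul_cancel_left₀ hc.ne']
  -- `‖log W_i‖ ≤ ‖W_i − 1‖/(1 − t) ≤ (4/3)‖W_i − 1‖`
  have hlog : ∀ i, ‖mlog (W i)‖ ≤ (4 / 3) * ‖W i - 1‖ := fun i => by
    have h1 : ‖W i - 1‖ < 1 := (hW i).trans_lt (by linarith)
    refine (norm_mlog_le_div h1).trans ?_
    rw [div_le_iff₀ (by linarith)]
    nlinarith [hW i, norm_nonneg (W i - 1)]
  have hBn : ‖B‖ ≤ (4 / 3) * m := by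
    refine (norm_mean_le_mean_norm _).trans ?_
    calc ((Fintype.card ι : ℝ))⁻¹ * ∑ i, ‖mlog (W i)‖ ≤ ((Fintype.card ι : ℝ))⁻¹ * ∑ i, (4 / 3) * ‖W i - 1‖ :=
          mul_le_mul_of_nonneg_left (Finset.sum_le_sum fun i _ => hlog i) (inv_nonneg.mpr (Nat.cast_nonneg _))
      _ = (4 / 3) * m := by rw [hm, ← Finset.mul_sum]; ring
  have hB1 : ‖B‖ ≤ 1 := hBn.trans (by nlinarith)
  -- `‖e^B − 1‖ ≤ e^{‖B‖} − 1 ≤ 2‖B‖`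
  have hexp : ‖exp B - 1‖ ≤ 2 * ‖B‖ := by
    refine (norm_exp_sub_one_le_exp_norm_sub_one B).trans ?_
    have h := Real.abs_exp_sub_one_le (x := ‖B‖) (by rw [abs_of_nonneg (norm_nonneg _)]; exact hB1)
    rw [abs_of_nonneg (norm_nonneg B)] at h
    exact (le_abs_self _).trans h
  rw [eml_eq_exp]
  calc ‖exp B - 1‖ ≤ 2 * ‖B‖ := hexp
    _ ≤ 2 * ((4 / 3) * m) := by gcongr
    _ ≤ 3 * m := by nlinarith

end Banach

/-! ## §2 `SU(N)` clothes and the record's correction factor -/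

section SUN

variable {n : Type*} [Fintype n] [DecidableEq n] [Nonempty n]
variable {ι : Type*} [Fintype ι] [Nonempty ι]

/-- ★★ **`ESU` IS MEAN-SMALL**: `dist1 (W i) ≤ t`, `t ≤ 1∕4`, `t < δ_N` ⟹ `dist1 (ESU W) ≤ 3·|I|⁻¹Σ_i dist1 (W i)`. [cite: Balaban1987RG1, (0.4) p.253] -/
theorem dist1_ESU_le_mean {W : ι → Matrix.specialUnitaryGroup n ℂ} {t : ℝ} (hW : ∀ i, dist1 (W i) ≤ t) (ht4 : t ≤ 1 / 4)
    (ht : t < deltaSU n) : dist1 (ESU W) ≤ 3 * (((Fintype.card ι : ℝ))⁻¹ * ∑ i, dist1 (W i)) := by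
  have hsmall : ∀ i, ‖(W i : Matrix n n ℂ) - 1‖ < deltaSU n := fun i => (hW i).trans_lt ht
  show ‖((ESU W : Matrix.specialUnitaryGroup n ℂ) : Matrix n n ℂ) - 1‖ ≤ 3 * (((Fintype.card ι : ℝ))⁻¹ * ∑ i, dist1 (W i))
  rw [coe_ESU_of_small hsmall]
  exact norm_eml_sub_one_le_mean (fun i => hW i) ht4

/-- The same for the tree's small-loop average `expMeanLogSU.avg` over any nonempty finite index type (fixed enumeration; the mean is reindexing
invariant). [cite: Balaban1987RG1, (0.4) and (0.7) p.253] -/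
theorem dist1_expMeanLogSU_avg_le_mean {W : ι → Matrix.specialUnitaryGroup n ℂ} {t : ℝ} (hW : ∀ i, dist1 (W i) ≤ t) (ht4 : t ≤ 1 / 4)
    (ht : t < deltaSU n) :
    dist1 ((expMeanLogSU (n := n)).avg W) ≤ 3 * (((Fintype.card ι : ℝ))⁻¹ * ∑ i, dist1 (W i)) := by
  unfold LoopAverage.avg
  have h := dist1_ESU_le_mean (W := W ∘ (LoopAverage.enum ι).symm) (fun i => hW _) ht4 ht
  have hcard : (Fintype.card (Fin (Fintype.card ι - 1 + 1)) : ℝ) = Fintype.card ι := by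
    rw [Fintype.card_fin, Nat.sub_add_cancel Fintype.card_pos]
  have hsum : ∑ i, dist1 ((W ∘ (LoopAverage.enum ι).symm) i) = ∑ i, dist1 (W i) :=
    Equiv.sum_comp (LoopAverage.enum ι).symm (fun i => dist1 (W i))
  rw [hcard, hsum] at h
  exact h

variable {P : Params} {j : ℕ}

/-- ★★ **THE RECORD's CORRECTION FACTOR IS MEAN-FLUX SMALL**: on the small-field domain with every loop variable `dist1 ≤ t ≤ 1∕4`, `t < δ_N`:
`dist1 (corr ℰp U c) ≤ 3·|Idx|⁻¹Σ_i dist1 (loopHol U c i)` — linear in the MEAN loop flux (each `loopHol` is a lasso of ≤ `C·L²` fine plaquettes, so F4's `ℓ²` letter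
follows from the ribbon kernel by ✓`schur_test`). [cite: Balaban1987RG1, (0.4) p.253] -/
theorem dist1_corr_le_mean (U : GaugeField P j (Matrix.specialUnitaryGroup n ℂ)) (c : PBond P (j + 1)) {t : ℝ}
    (hθ : ∀ i, dist1 (loopHol U c i) ≤ t) (ht4 : t ≤ 1 / 4) (ht : t < deltaSU n) :
    dist1 (corr (expMeanLogSU (n := n)) U c) ≤ 3 * (((Fintype.card (Idx P) : ℝ))⁻¹ * ∑ i, dist1 (loopHol U c i)) := by
  have hsmall : Small (expMeanLogSU (n := n)) U c := fun i => (hθ i).trans_lt ht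
  unfold corr
  rw [if_pos hsmall]
  exact dist1_expMeanLogSU_avg_le_mean hθ ht4 ht

end SUN

end Summit.QuantumFields.YangMills.Theorems.FluctuationComparisonRegPrIntLS2BetaCorrMeanFlux

end
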